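import Literature.Computability.Complexity.MatchingRestriction
import Literature.Computability.Complexity.MatchingDegreeIncrease
import HarnessLib

/-!
# Localizing a combination of matching monomials at a vertex (BBCHPRRWZ 2017, proof of Thm 4.9)

Braun–Brown-Cohen–Huq–Pokutta–Raghavendra–Roy–Weitz–Zink, *The matching problem has no small
symmetric SDP*, Math. Program. 165 (2017), proof of Theorem 4.9 (the Claim): every summand
`L_e x_e` with `e ∋ a` is multiplied by the vertex generator `Σ_v x_{uv} ≅ 1` and reduced with the
disjointness axioms, so that `F - σF ≅ Σ_{b,v} L'_{bv} x_{ab} x_{uv}` with `L'_{bv}` living on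
`K_n ∖ {a,b,u,v}`, and then "`L'_{bv}` is zero on all perfect matchings containing `{a,b}` and
`{u,v}`; by induction `L'_{bv} ≅ 0` … by two applications of Lemma 4.8".  This file isolates the
two reusable steps of that argument, for ONE vertex `w` at a time:

* `localize` — a combination `Σ_j c_j x_{N_j}` of matching monomials is congruent (Lemma 4.5 at
  `w` for the `N_j` not covering `w`) to `Σ_{b ≠ w} ι_b(D_b) · x_{wb}` with explicit combinations
  `D_b = locD …` of matching monomials on `K_m = K_{m+2} ∖ {w, b}` (`MatchingRestriction.lean`);
* `hasDerivationOfDegree_of_local` — if such a localized sum vanishes on all perfect matchings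
  and each `D_b` is derivable in degree `Deg` AS SOON AS it vanishes on the perfect matchings of
  `K_m`, then the sum is derivable in degree `Deg + 1` (evaluation at the extended matchings
  `ι_b(P₀) ∪ {wb}` isolates `D_b`; then Lemma 4.8, `degreeIncrease`).

## References

* G. Braun et al., *The matching problem has no small symmetric SDP*, Math. Program. 165 (2017)
  643–662, proof of Thm 4.9 (arXiv:1504.00703, p. 9). [BraunEtAl2016]
-/

noncomputable section

open MvPolynomial Finset
open Literature.Barriers.PneNP (IsPMOn)

namespace Literature.Computability.Complexity

namespace Mod2

variable {m : ℕ}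

/-- `F` vanishes on all perfect matchings of `K_n`. [cite: BraunEtAl2016, §4.2 (p. 7, "F ≡ 0")] -/
def VanishesOnPM {n : ℕ} (F : MvPolynomial (KnEdge n) ℝ) : Prop :=
  ∀ P : Finset (Sym2 (Fin n)), IsPMOn univ P → eval (edgeIndicator P) F = 0

/-- The localized term `ι_b(D_b) · x_{wb}` (zero for `b = w`).
[cite: BraunEtAl2016, Thm. 4.9 (proof, "L'_{bv} x_{ab} x_{uv}")] -/
def Hterm (w : Fin (m + 2)) (ι : Fin (m + 2) → (Fin m ↪ Fin (m + 2)))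
    (D : Fin (m + 2) → MvPolynomial (KnEdge m) ℝ) (b : Fin (m + 2)) : MvPolynomial (KnEdge (m + 2)) ℝ :=
  if h : b = w then 0 else polyEmbed (ι b) (D b) * X (newEdge w b (Ne.symm h))

/-! ### Derivability of a localized sum from the derivability of its coefficients -/

/-- **Local-to-global step of the Claim.** Let `H = Σ_{b ≠ w} ι_b(D_b) x_{wb}` with `ι_b` missing
exactly `w, b`. If `H` vanishes on all perfect matchings of `K_{m+2}` and each `D_b` is derivable
from `𝒫_m` in degree `Deg` once it vanishes on the perfect matchings of `K_m`, then `H` is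
derivable from `𝒫_{m+2}` in degree `Deg + 1`. [cite: BraunEtAl2016, Thm. 4.9 (proof) with Lemma 4.8] -/
theorem hasDerivationOfDegree_of_local (hm : m ≠ 1) (w : Fin (m + 2))
    (ι : Fin (m + 2) → (Fin m ↪ Fin (m + 2)))
    (hι : ∀ b, b ≠ w → ∀ v : Fin (m + 2), v ∉ Set.range (ι b) ↔ v = w ∨ v = b)
    (D : Fin (m + 2) → MvPolynomial (KnEdge m) ℝ) {Deg : ℕ}
    (hder : ∀ b, b ≠ w → VanishesOnPM (D b) → HasDerivationOfDegree (system m) (D b) Deg)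
    (hvan : VanishesOnPM (∑ b ∈ univ.erase w, Hterm w ι D b)) :
    HasDerivationOfDegree (system (m + 2)) (∑ b ∈ univ.erase w, Hterm w ι D b) (Deg + 1) := by
  classical
  refine HasDerivationOfDegree.sum fun b hb => ?_
  have hbw : b ≠ w := (mem_erase.1 hb).1
  rw [Hterm, dif_neg hbw]
  refine degreeIncrease hm (ι b) w b (Ne.symm hbw) (hι b hbw) (D b) Deg (hder b hbw fun P₀ hP₀ => ?_)
  -- evaluate `H` at the extended matching `ι_b(P₀) ∪ {wb}`
  have h := hvan _ (isPMOn_extendPM (Ne.symm hbw) (hι b hbw) hP₀)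
  rw [map_sum, Finset.sum_eq_single b] at h
  · rw [Hterm, dif_neg hbw, map_mul, eval_polyEmbed_extendPM (hι b hbw)] at h
    change eval (edgeIndicator P₀) (D b) *
      eval (edgeIndicator (extendPM (ι b) w b P₀)) (X (newEdge w b (Ne.symm hbw))) = 0 at h
    rw [newEdge, eval_X_pair_extendPM (Ne.symm hbw), mul_one] at h
    exact h
  · intro b' hb' hb'b
    have hb'w : b' ≠ w := (mem_erase.1 hb').1
    rw [Hterm, dif_neg hb'w, map_mul]
    have : eval (edgeIndicator (extendPM (ι b) w b P₀)) (X (newEdge w b' (Ne.symm hb'w))) = 0 := by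
      refine eval_X_eq_zero_extendPM (hι b hbw) P₀ (Or.inl (Sym2.mem_mk_left _ _)) ?_
      change (s(w, b') : Sym2 (Fin (m + 2))) ≠ s(w, b)
      exact fun h => hb'b (Sym2.congr_right.1 h)
    rw [this, mul_zero]
  · exact fun h => absurd hb h

/-! ### Localizing a combination of matching monomials at `w` -/

variable {κ : Type*} (w : Fin (m + 2)) (ι : Fin (m + 2) → (Fin m ↪ Fin (m + 2)))

/-- Sums over the edges at `w` are sums over the far endpoints. [cite: BraunEtAl2016, §4.2 (p. 7, "Σ_{u} x_{uv}")] -/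
theorem sum_edgesAt_eq_sum_vertices {M : Type*} [AddCommMonoid M] (f : KnEdge (m + 2) → M) :
    ∑ e ∈ univ.filter (fun e : KnEdge (m + 2) => w ∈ (e : Sym2 (Fin (m + 2)))), f e =
      ∑ b ∈ univ.erase w, (if h : b = w then 0 else f (newEdge w b (Ne.symm h))) := by
  classical
  refine Finset.sum_bij' (fun e he => Sym2.Mem.other (mem_filter.1 he).2)
    (fun b hb => newEdge w b (Ne.symm (mem_erase.1 hb).1)) ?_ ?_ ?_ ?_ ?_
  · intro e he
    exact mem_erase.2 ⟨Sym2.other_ne e.2 (mem_filter.1 he).2, mem_univ _⟩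
  · intro b hb
    exact mem_filter.2 ⟨mem_univ _, Sym2.mem_mk_left _ _⟩
  · intro e he
    exact Subtype.ext (Sym2.other_spec (mem_filter.1 he).2)
  · intro b hb
    have h := Sym2.other_spec (Sym2.mem_mk_left w b : w ∈ (s(w, b) : Sym2 (Fin (m + 2))))
    exact Sym2.congr_right.1 h
  · intro e he
    rw [dif_neg (Sym2.other_ne e.2 (mem_filter.1 he).2)]
    congr 1
    exact Subtype.ext (Sym2.other_spec (mem_filter.1 he).2).symm

/-- The edge set carried along by the term `j`: `N_j` with its edge at `w` removed.
[cite: BraunEtAl2016, Thm. 4.9 (proof)] -/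
def locR (N : κ → Finset (KnEdge (m + 2))) (j : κ) : Finset (KnEdge (m + 2)) :=
  (N j).filter fun e : KnEdge (m + 2) => w ∉ (e : Sym2 (Fin (m + 2)))

/-- The edges at `w` selected by the term `j`: its own edge at `w` if `N_j` covers `w`, else the
free edges at `w` (Lemma 4.5). [cite: BraunEtAl2016, Thm. 4.9 (proof) with Lemma 4.5] -/
def locSel (N : κ → Finset (KnEdge (m + 2))) (j : κ) : Finset (KnEdge (m + 2)) :=
  if w ∈ verts (N j) then (N j).filter (fun e : KnEdge (m + 2) => w ∈ (e : Sym2 (Fin (m + 2))))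
  else freeEdgesAt (N j) w

/-- **The coefficient `D_b`** of the localization: a combination of pulled-back matching monomials.
[cite: BraunEtAl2016, Thm. 4.9 (proof, "L'_{bv}")] -/
def locD (J : Finset κ) (c : κ → ℝ) (N : κ → Finset (KnEdge (m + 2))) (b : Fin (m + 2)) :
    MvPolynomial (KnEdge m) ℝ :=
  ∑ j ∈ J.filter (fun j => ∃ h : b ≠ w, newEdge w b (Ne.symm h) ∈ locSel w N j),
    c j • xM (pullEdges (ι b) (locR w N j))

variable {w}

/-- Selected edges contain `w`. [cite: BraunEtAl2016, Thm. 4.9 (proof)] -/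
theorem mem_of_mem_locSel {N : κ → Finset (KnEdge (m + 2))} {j : κ} {e : KnEdge (m + 2)}
    (he : e ∈ locSel w N j) : w ∈ (e : Sym2 (Fin (m + 2))) := by
  unfold locSel at he
  split_ifs at he
  · exact (mem_filter.1 he).2
  · exact (mem_freeEdgesAt.1 he).1

/-- `locR` avoids `w`. [cite: BraunEtAl2016, Thm. 4.9 (proof)] -/
theorem not_mem_verts_locR (N : κ → Finset (KnEdge (m + 2))) (j : κ) : w ∉ verts (locR w N j) := by
  intro h
  obtain ⟨e, he, hwe⟩ := mem_verts.1 h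
  exact (mem_filter.1 he).2 hwe

/-- For a partial matching, `locR` also avoids the far endpoint of a selected edge.
[cite: BraunEtAl2016, Thm. 4.9 (proof)] -/
theorem not_mem_verts_locR_of_sel {N : κ → Finset (KnEdge (m + 2))} {j : κ}
    (hpm : IsPartialMatching (N j)) {b : Fin (m + 2)} (hb : b ≠ w)
    (hsel : newEdge w b (Ne.symm hb) ∈ locSel w N j) : b ∉ verts (locR w N j) := by
  intro h
  obtain ⟨f, hf, hbf⟩ := mem_verts.1 h
  obtain ⟨hfN, hwf⟩ := mem_filter.1 hf
  unfold locSel at hsel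
  split_ifs at hsel with hw
  · -- `{w,b} ∈ N j` and `f ∈ N j` share `b`
    have he := (mem_filter.1 hsel).1
    have hne : newEdge w b (Ne.symm hb) ≠ f := fun h => hwf (h ▸ Sym2.mem_mk_left _ _)
    exact hpm _ he _ hfN hne b ⟨Sym2.mem_mk_right _ _, hbf⟩
  · -- `{w,b}` free: `b ∉ verts (N j)`
    exact (mem_freeEdgesAt.1 hsel).2 b (mem_verts.2 ⟨f, hfN, hbf⟩) (Sym2.mem_mk_right _ _)

/-- Under the selection, `locR` lives in the image of `ι_b`. [cite: BraunEtAl2016, Thm. 4.9 (proof)] -/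
theorem verts_locR_subset_range (hι : ∀ b, b ≠ w → ∀ v : Fin (m + 2), v ∉ Set.range (ι b) ↔ v = w ∨ v = b)
    {N : κ → Finset (KnEdge (m + 2))} {j : κ} (hpm : IsPartialMatching (N j)) {b : Fin (m + 2)}
    (hb : b ≠ w) (hsel : newEdge w b (Ne.symm hb) ∈ locSel w N j) :
    ∀ v ∈ verts (locR w N j), v ∈ Set.range (ι b) := by
  intro v hv
  by_contra h
  rcases (hι b hb v).1 h with rfl | rfl
  · exact not_mem_verts_locR N j hv
  · exact not_mem_verts_locR_of_sel hpm hb hsel hv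

/-- **The term-wise localization**: `x_{N_j} ≅ Σ_{e selected} x_{locR_j} x_e` (an identity if
`N_j` covers `w`, Lemma 4.5 at `w` otherwise). [cite: BraunEtAl2016, Thm. 4.9 (proof) with Lemma 4.5] -/
theorem isCong_xM_locSel {N : κ → Finset (KnEdge (m + 2))} {j : κ} (hpm : IsPartialMatching (N j))
    {t : ℕ} (ht : w ∉ verts (N j) → (N j).card + 1 ≤ t) :
    IsCong (system (m + 2)) t (xM (N j)) (∑ e ∈ locSel w N j, xM (locR w N j) * X e) := by
  classical
  unfold locSel
  split_ifs with hw
  · -- `N_j` covers `w` by a unique edge `e₀`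
    obtain ⟨e₀, he₀, hwe₀⟩ := mem_verts.1 hw
    have hfilt : (N j).filter (fun e : KnEdge (m + 2) => w ∈ (e : Sym2 (Fin (m + 2)))) = {e₀} := by
      ext e
      rw [mem_filter, mem_singleton]
      constructor
      · rintro ⟨he, hwe⟩
        by_contra hne
        exact hpm e he e₀ he₀ hne w ⟨hwe, hwe₀⟩
      · rintro rfl; exact ⟨he₀, hwe₀⟩
    have hR : locR w N j = (N j).erase e₀ := by
      ext e
      rw [locR, mem_filter, mem_erase]
      constructor
      · rintro ⟨he, hwe⟩
        exact ⟨fun h => hwe (h ▸ hwe₀), he⟩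
      · rintro ⟨hne, he⟩
        exact ⟨he, fun hwe => hpm e he e₀ he₀ hne w ⟨hwe, hwe₀⟩⟩
    rw [hfilt, sum_singleton, hR, xM, xM, mul_comm, mul_prod_erase _ _ he₀]
    exact IsCong.refl _
  · -- Lemma 4.5 at `w`
    have hR : locR w N j = N j := by
      ext e
      rw [locR, mem_filter, and_iff_left_iff_imp]
      exact fun he hwe => hw (mem_verts.2 ⟨e, he, hwe⟩)
    rw [hR]
    refine (isCong_xM_grow (M := N j) hw).mono (ht hw) |>.trans ?_
    have : ∑ e ∈ freeEdgesAt (N j) w, xM (insert e (N j)) = ∑ e ∈ freeEdgesAt (N j) w, xM (N j) * X e :=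
      sum_congr rfl fun e he => by rw [xM_insert (not_mem_of_mem_freeEdgesAt he), mul_comm]
    rw [this]
    exact IsCong.refl _

/-- **Localization at `w`.** A combination of matching monomials `Σ_j c_j x_{N_j}` (partial
matchings, `|N_j| + 1 ≤ t` whenever `N_j` misses `w`) is congruent in degree `t` to the localized
sum `Σ_{b ≠ w} ι_b(D_b) · x_{wb}` with `D_b = locD …`. [cite: BraunEtAl2016, Thm. 4.9 (proof)] -/
theorem localize (hι : ∀ b, b ≠ w → ∀ v : Fin (m + 2), v ∉ Set.range (ι b) ↔ v = w ∨ v = b)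
    (J : Finset κ) (c : κ → ℝ) (N : κ → Finset (KnEdge (m + 2)))
    (hpm : ∀ j ∈ J, IsPartialMatching (N j)) {t : ℕ}
    (ht : ∀ j ∈ J, w ∉ verts (N j) → (N j).card + 1 ≤ t) :
    IsCong (system (m + 2)) t (∑ j ∈ J, c j • xM (N j))
      (∑ b ∈ univ.erase w, Hterm w ι (locD w ι J c N) b) := by
  classical
  -- term-wise localization
  have h1 : IsCong (system (m + 2)) t (∑ j ∈ J, c j • xM (N j))
      (∑ j ∈ J, c j • ∑ e ∈ locSel w N j, xM (locR w N j) * X e) :=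
    IsCong.sum fun j hj => (isCong_xM_locSel (hpm j hj) (ht j hj)).smul (c j)
  refine h1.trans ?_
  -- regroup by the edge at `w`, then by its far endpoint
  set atW := univ.filter (fun e : KnEdge (m + 2) => w ∈ (e : Sym2 (Fin (m + 2)))) with hatW
  have hsub : ∀ j ∈ J, locSel w N j ⊆ atW := fun j _ e he =>
    mem_filter.2 ⟨mem_univ _, mem_of_mem_locSel he⟩
  have h2 : (∑ j ∈ J, c j • ∑ e ∈ locSel w N j, xM (locR w N j) * X e) =
      ∑ e ∈ atW, (∑ j ∈ J.filter (fun j => e ∈ locSel w N j), c j • xM (locR w N j)) * X e := by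
    calc (∑ j ∈ J, c j • ∑ e ∈ locSel w N j, xM (locR w N j) * X e)
        = ∑ j ∈ J, ∑ e ∈ atW, (if e ∈ locSel w N j then c j • (xM (locR w N j) * X e) else 0) := by
          refine sum_congr rfl fun j hj => ?_
          rw [← sum_filter, filter_mem_eq_inter, inter_eq_right.2 (hsub j hj), smul_sum]
      _ = ∑ e ∈ atW, ∑ j ∈ J, (if e ∈ locSel w N j then c j • (xM (locR w N j) * X e) else 0) := sum_comm
      _ = ∑ e ∈ atW, (∑ j ∈ J.filter (fun j => e ∈ locSel w N j), c j • xM (locR w N j)) * X e := by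
          refine sum_congr rfl fun e _ => ?_
          rw [sum_filter, sum_mul]
          refine sum_congr rfl fun j _ => ?_
          split_ifs
          · exact (smul_mul_assoc _ _ _).symm
          · exact (zero_mul _).symm
  rw [h2, hatW, sum_edgesAt_eq_sum_vertices]
  refine IsCong.sum fun b hb => ?_
  have hbw : b ≠ w := (mem_erase.1 hb).1
  rw [dif_neg hbw, Hterm, dif_neg hbw, locD, map_sum]
  have hfilt : J.filter (fun j => newEdge w b (Ne.symm hbw) ∈ locSel w N j) =
      J.filter (fun j => ∃ h : b ≠ w, newEdge w b (Ne.symm h) ∈ locSel w N j) :=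
    filter_congr fun j _ => ⟨fun h => ⟨hbw, h⟩, fun ⟨_, h⟩ => h⟩
  rw [← hfilt]
  have hsum : ∑ j ∈ J.filter (fun j => newEdge w b (Ne.symm hbw) ∈ locSel w N j),
      polyEmbed (ι b) (c j • xM (pullEdges (ι b) (locR w N j))) =
      ∑ j ∈ J.filter (fun j => newEdge w b (Ne.symm hbw) ∈ locSel w N j), c j • xM (locR w N j) := by
    refine sum_congr rfl fun j hj => ?_
    obtain ⟨hjJ, hsel⟩ := mem_filter.1 hj
    rw [map_smul, polyEmbed_xM_pullEdges (ι b) (verts_locR_subset_range ι hι (hpm j hjJ) hbw hsel)]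
  rw [hsum]
  exact IsCong.refl _

end Mod2

end Literature.Computability.Complexity
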